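import Summits.ResolutionOfSingularities.ResolutionOfSingularities.Theorems.FrobeniusClosingSteerBetaPolygonMono
import Summits.ResolutionOfSingularities.ResolutionOfSingularities.Theorems.FrobeniusClosingSteerBetaHatStageWords
import HarnessLib

/-!
# Crux `Steer` (stmt-ResolutionOfSingularities-16345), chain W4.1 — the β-slot `ShearLetterHat` (SLH-repaired) DISCHARGED at word level:
# `shearLetterHat_of_words`

OURS (campaign `res-hironaka`, rung L ★L-G4, slot W4.1; seat res-L0-w41-stub-4 g7 on res-L0-w41-plan-1 RULINGS 190c/200b/207(a) «SLH.3»).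
Replaces the role of no printed item; NOT a statement of the manuscript under review [claim: Hironaka2017, status: under-review]; AI-produced,
weaker than expert review. Theses-free, definition-free. Words: the tree's `IsArithStage` (`…BetaHatStageWords`, p552756) and `IsVStarTw` /
`IsDeltaStarTw` (`…BetaPolygonGauge`, p540729).

* `span_quad_shear` — `(x, y + x·t, z, w) = (x, y, z, w)`; `span_pair_shear` — `(x, y + x·t) = (x, y)`.
* `isArithStage_shear` — the stage datum survives the upstairs shear when the twist is `y`-free with exponent `a ≤ 1` (the SLH repair: with
  unbounded `a` the slot is FALSE, witness `u = xy = x²` in `𝔽₂[x,y,z,w]_𝔪/(xy − x²)` — res-L0-w41-stub-4 190c finding, idea-1 R-SH, RULING 200b).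
* `isVStarTw_shear`, `isDeltaStarTw_shear` — the star data survive (tree `isVStarTw_shear_iff` / `isDeltaStarTw_shear_iff`, p543830, with `c := −t`).
* `shearLetterHat_of_words` — binder for binder the body of the repaired word `ShearLetterHat` (β-leaf `Sketch-idea-1-v18-hatleaf.v184-J4K7SHCP.lean`
  638f2c3836e9ecc5; tri-2 ONE-HUNK PASS): the leaf's `shearLetterHat_holds : ShearLetterHat := fun S _ _ x y z w u f t d => shearLetterHat_of_words …`.

[cite: CossartJannsenSaito2020, Lemma 13.6] [folklore]
bears_on: LADDER-RESOLUTION L ★L-G4 W4.1 (crux `Steer`, binder hK4ⁿᶜ, β-slot `ShearLetterHat`).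
-/

noncomputable section

-- `Summit.<S>.<S>.…` duplicates the summit name by design (single-problem summit).
set_option linter.dupNamespace false

open IsLocalRing
open Summit.ResolutionOfSingularities.ResolutionOfSingularities.Theorems.SwitchingDichotomy.BetaPolygon

namespace Summit.ResolutionOfSingularities.ResolutionOfSingularities.Theorems.SwitchingDichotomy.BetaPolygonMoves

variable {S : Type} [CommRing S]

/-- The sheared pair generates the same ideal: `(x, y + x·t) = (x, y)`. -/
theorem span_pair_shear (x y t : S) : Ideal.span ({x, y + x * t} : Set S) = Ideal.span {x, y} := by
  apply le_antisymm
  · rw [Ideal.span_le]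
    rintro s hs
    simp only [Set.mem_insert_iff, Set.mem_singleton_iff] at hs
    rcases hs with rfl | rfl
    · exact Ideal.subset_span (by simp)
    · exact Ideal.add_mem _ (Ideal.subset_span (by simp)) (Ideal.mul_mem_right _ _ (Ideal.subset_span (by simp)))
  · rw [Ideal.span_le]
    rintro s hs
    simp only [Set.mem_insert_iff, Set.mem_singleton_iff] at hs
    rcases hs with rfl | rfl
    · exact Ideal.subset_span (by simp)
    · have h : s = (s + x * t) - x * t := by ring
      rw [h]
      exact Ideal.sub_mem _ (Ideal.subset_span (by simp)) (Ideal.mul_mem_right _ _ (Ideal.subset_span (by simp)))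

/-- The sheared r.s.o.p. generates the same ideal: `(x, y + x·t, z, w) = (x, y, z, w)`. -/
theorem span_quad_shear (x y z w t : S) : Ideal.span ({x, y + x * t, z, w} : Set S) = Ideal.span {x, y, z, w} := by
  have h1 : ({x, y + x * t, z, w} : Set S) = {x, y + x * t} ∪ {z, w} := by
    ext s; simp only [Set.mem_insert_iff, Set.mem_singleton_iff, Set.mem_union]; tauto
  have h2 : ({x, y, z, w} : Set S) = {x, y} ∪ {z, w} := by
    ext s; simp only [Set.mem_insert_iff, Set.mem_singleton_iff, Set.mem_union]; tauto
  rw [h1, h2, Ideal.span_union, Ideal.span_union, span_pair_shear]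

variable [IsLocalRing S]

/-- **The stage datum survives the upstairs shear** `y ↦ y + x·t` when the twist is `x^a`, `a ≤ 1`. -/
theorem isArithStage_shear (x y z w u f t : S) (d : ℕ) (hst : IsArithStage S x y z w u f d) (hu : ∃ a : ℕ, a ≤ 1 ∧ u = x ^ a) :
    IsArithStage S x (y + x * t) z w u f d := by
  obtain ⟨hspan, -, Ψ, hΨ, han, hcong⟩ := hst
  obtain ⟨a, ha, hu⟩ := hu
  refine ⟨by rw [span_quad_shear, hspan], ⟨a, 0, ha, Nat.zero_le _, by rw [hu, pow_zero, mul_one]⟩, Ψ, hΨ, han, ?_⟩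
  rwa [span_pair_shear]

omit [IsLocalRing S] in
/-- **The twisted left vertex survives the upstairs shear.** [cite: CossartJannsenSaito2020, Lemma 13.6] -/
theorem isVStarTw_shear (u x y z w t : S) (d : ℕ) (α β : ℚ) (f : S) (h : IsVStarTw u x y z w d α β f) :
    IsVStarTw u x (y + x * t) z w d α β f := by
  have h' := (isVStarTw_shear_iff u x y z w (-t) d α β f).mp h
  rwa [show y - -t * x = y + x * t by ring] at h'

omit [IsLocalRing S] in
/-- **The twisted `δ*` survives the upstairs shear.** [cite: CossartJannsenSaito2020, Lemma 13.6] -/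
theorem isDeltaStarTw_shear (u x y z w t : S) (d : ℕ) (δ : ℚ) (f : S) (h : IsDeltaStarTw u x y z w d δ f) :
    IsDeltaStarTw u x (y + x * t) z w d δ f := by
  have h' := (isDeltaStarTw_shear_iff u x y z w (-t) d δ f).mp h
  rwa [show y - -t * x = y + x * t by ring] at h'

/-- **`ShearLetterHat` (SLH-repaired) at word level.** See the module docstring. -/
theorem shearLetterHat_of_words (S : Type) [CommRing S] [IsLocalRing S] (x y z w u f t : S) (d : ℕ)
    (hst : IsArithStage S x y z w u f d) (hu : ∃ a : ℕ, a ≤ 1 ∧ u = x ^ a) :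
    IsArithStage S x (y + x * t) z w u f d ∧
    (∀ α β : ℚ, IsVStarTw u x y z w d α β f → IsVStarTw u x (y + x * t) z w d α β f) ∧
    (∀ δ : ℚ, IsDeltaStarTw u x y z w d δ f → IsDeltaStarTw u x (y + x * t) z w d δ f) :=
  ⟨isArithStage_shear x y z w u f t d hst hu, fun α β h => isVStarTw_shear u x y z w t d α β f h,
    fun δ h => isDeltaStarTw_shear u x y z w t d δ f h⟩

end Summit.ResolutionOfSingularities.ResolutionOfSingularities.Theorems.SwitchingDichotomy.BetaPolygonMoves

end
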